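import Mathlib
import Summits.NavierStokesRegularity.NavierStokesRegularity.Theorems.LevelSetModerationLevelSetClosureSliceGain
import Summits.NavierStokesRegularity.NavierStokesRegularity.Theorems.LevelSetModerationHighSpeedPressureWorkConsequences

/-!
# Route LevelSetModeration — crux 2 `HighSpeedPressureWork`: the isoperimetric (p = 1) level gain

Support lemmas for item stmt-NavierStokesRegularity-18149
(`Summit.NavierStokesRegularity.NavierStokesRegularity.Theses.LevelSetModeration.HighSpeedPressureWork`),
first lemma `IsoperimetricLevelGain` of the round-2 crux idea `iso-speed-area-closure` (linear
dyadic level recursion in the AREA currency `ν ∫∫ 1_{|u|>c} |∇|u||`): the `p = 1` sibling of the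
two-level Chebyshev–Sobolev slice gain `sliceVolumeGain` of crux 3.

* `lintegral_indicator_fderiv_norm_lt_top` — for a `C¹` field `v` and a level `c > 0` with bounded
  super-level set `{|v| > c}`, the level-set area integrand is integrable:
  `∫ 1_{|v|>c} ‖∇|v|‖ < ∞` (`‖∇|v|‖ ≤ ‖∇v‖`, continuous on the compact closure).
* `sliceVolumeGain_one` — for `v ∈ C¹(ℝ³; ℝ³)`, levels `0 < k < h`, `{|v| > k}` bounded:
  `|{|v| > h}| ≤ (4/(h−k))^{3/2} C₁ (∫ 1_{|v|>k} ‖∇|v|‖)^{3/2}`,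
  `C₁ = lintegralPowLePowLIntegralFDerivConst volume (3/2)` (two-level `C¹` truncation
  `exists_truncation`, Chebyshev on `L^{3/2}`, Mathlib's `L¹` Gagliardo–Nirenberg–Sobolev
  inequality `lintegral_pow_le_pow_lintegral_fderiv`).
* `isoperimetricLevelGain` — the dyadic real form of the idea card:
  `c · |{|v| > 2c}|^{2/3} ≤ C ∫ 1_{|v|>c} ‖∇|v|‖` with one absolute constant `C`.

## References
* E. De Giorgi (1957) / G. Stampacchia: level truncation; L. C. Evans, *PDE*, §5.6.1 (GNS, p = 1).
* A. Vasseur, NoDEA 14 (2007), §4 (the level-set currency). [Vasseur2007]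
-/

noncomputable section

-- single-conjunct summit: `Summit.<Summit>.<Problem>` repeats the name by the D-0017 layout
set_option linter.dupNamespace false

namespace Summit.NavierStokesRegularity.NavierStokesRegularity.Theorems

open MeasureTheory Set Filter Topology Function Module
open scoped ENNReal NNReal

/-- **Finiteness of the level-set area integrand.** For a `C¹` field `v` on `ℝ³` and a level
`c > 0` with bounded super-level set `{|v| > c}`: `∫ 1_{|v|>c} ‖∇|v|‖ < ∞` (on the set,
`‖∇|v|(x)‖ ≤ ‖∇v(x)‖`, which is bounded on the compact closure). [folklore] -/
theorem lintegral_indicator_fderiv_norm_lt_top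
    {v : EuclideanSpace ℝ (Fin 3) → EuclideanSpace ℝ (Fin 3)} (hv : ContDiff ℝ 1 v) {c : ℝ}
    (hc : 0 < c) (hbdd : Bornology.IsBounded {x | c < ‖v x‖}) :
    ∫⁻ x, {x | c < ‖v x‖}.indicator (fun x => ‖fderiv ℝ (fun y => ‖v y‖) x‖ₑ) x < ∞ := by
  set A : Set (EuclideanSpace ℝ (Fin 3)) := {x | c < ‖v x‖} with hA
  have hK : IsCompact (closure A) := hbdd.isCompact_closure
  -- bound of `‖∇v‖` on the compact closure
  have hcont : ContinuousOn (fun x => fderiv ℝ v x) (closure A) :=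
    (hv.continuous_fderiv one_ne_zero).continuousOn
  obtain ⟨M, hM⟩ := hK.exists_bound_of_continuousOn hcont
  have hmeasA : MeasurableSet A :=
    (isOpen_lt continuous_const hv.continuous.norm).measurableSet
  -- pointwise bound of the integrand by `M · 1_A`
  have hle : ∀ x, A.indicator (fun x => ‖fderiv ℝ (fun y => ‖v y‖) x‖ₑ) x ≤
      A.indicator (fun _ => ENNReal.ofReal M) x := by
    intro x
    by_cases hx : x ∈ A
    · rw [indicator_of_mem hx, indicator_of_mem hx]
      have hvx : v x ≠ 0 := by
        intro h0
        have : c < ‖v x‖ := hx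
        rw [h0, norm_zero] at this
        exact lt_irrefl _ (this.trans hc)
      have h1 := norm_fderiv_norm_comp_le (hv.differentiable one_ne_zero x) hvx
      rw [← ofReal_norm]
      exact ENNReal.ofReal_le_ofReal (h1.trans (hM x (subset_closure hx)))
    · rw [indicator_of_notMem hx, indicator_of_notMem hx]
  calc ∫⁻ x, A.indicator (fun x => ‖fderiv ℝ (fun y => ‖v y‖) x‖ₑ) x
      ≤ ∫⁻ x, A.indicator (fun _ => ENNReal.ofReal M) x := lintegral_mono hle
    _ = ENNReal.ofReal M * volume A := by rw [lintegral_indicator_const hmeasA]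
    _ < ∞ := ENNReal.mul_lt_top ENNReal.ofReal_lt_top
        ((measure_mono subset_closure).trans_lt hK.measure_lt_top)


/-- **Isoperimetric (`p = 1`) slice volume gain.** For a `C¹` field `v` on `ℝ³` and levels
`0 < k < h` with `{|v| > k}` bounded:
`|{|v| > h}| ≤ (4/(h−k))^{3/2} · C₁ · (∫ 1_{|v|>k} ‖∇|v|‖)^{3/2}`,
`C₁ = lintegralPowLePowLIntegralFDerivConst volume (3/2)` — two-level `C¹` truncation of the speed
(`exists_truncation`), Chebyshev on `L^{3/2}` and the `L¹` Gagliardo–Nirenberg–Sobolev inequality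
(Mathlib `lintegral_pow_le_pow_lintegral_fderiv`, compact support from the bounded super-level
set). [folklore] -/
theorem sliceVolumeGain_one
    (v : EuclideanSpace ℝ (Fin 3) → EuclideanSpace ℝ (Fin 3)) (k h : ℝ) (hv : ContDiff ℝ 1 v)
    (hk : 0 < k) (hkh : k < h) (hbdd : Bornology.IsBounded {x | k < ‖v x‖}) :
    volume {x | h < ‖v x‖} ≤
      ENNReal.ofReal ((4 / (h - k)) ^ (3 / 2 : ℝ)) *
        (lintegralPowLePowLIntegralFDerivConst
            (volume : Measure (EuclideanSpace ℝ (Fin 3))) (3 / 2 : ℝ) : ℝ≥0∞) *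
        (∫⁻ x, {x | k < ‖v x‖}.indicator (fun x => ‖fderiv ℝ (fun y => ‖v y‖) x‖ₑ) x) ^
          (3 / 2 : ℝ) := by
  obtain ⟨w, hwC1, hw0, hwsq, hwlow, hwgrad⟩ := exists_truncation v k h hv hk hkh
  set A : Set (EuclideanSpace ℝ (Fin 3)) := {x | k < ‖v x‖} with hA
  set C₁ : ℝ≥0 := lintegralPowLePowLIntegralFDerivConst
    (volume : Measure (EuclideanSpace ℝ (Fin 3))) (3 / 2 : ℝ) with hC₁
  have hw_meas : AEStronglyMeasurable w volume := hwC1.continuous.aestronglyMeasurable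
  -- `w` vanishes off `A`, hence has compact support
  have hw_zero : ∀ x, x ∉ A → w x = 0 := by
    intro x hx
    have hxk : ‖v x‖ - k ≤ 0 := by
      have : ¬ k < ‖v x‖ := hx
      linarith [not_lt.1 this]
    have h1 : w x ^ 2 ≤ 0 := by
      have := hwsq x
      rwa [max_eq_right hxk, zero_pow two_ne_zero] at this
    have h2 : w x ^ 2 = 0 := le_antisymm h1 (sq_nonneg _)
    exact pow_eq_zero_iff two_ne_zero |>.1 h2
  have hw_supp : HasCompactSupport w := by
    refine HasCompactSupport.intro hbdd.isCompact_closure fun x hx => hw_zero x ?_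
    exact fun hxA => hx (subset_closure hxA)
  -- the `L¹` Gagliardo–Nirenberg–Sobolev inequality for `w`
  have hp : Real.HolderConjugate (finrank ℝ (EuclideanSpace ℝ (Fin 3)) : ℝ) (3 / 2 : ℝ) := by
    rw [finrank_euclideanSpace_fin]
    exact ⟨by norm_num, by norm_num, by norm_num⟩
  have hGNS := lintegral_pow_le_pow_lintegral_fderiv
    (volume : Measure (EuclideanSpace ℝ (Fin 3))) hwC1 hw_supp hp
  -- `∫ ‖∇w‖ ≤ ∫ 1_A ‖∇|v|‖`
  have hgrad_int : ∫⁻ x, ‖fderiv ℝ w x‖ₑ ≤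
      ∫⁻ x, A.indicator (fun x => ‖fderiv ℝ (fun y => ‖v y‖) x‖ₑ) x := by
    refine lintegral_mono fun x => ?_
    have h1 := hwgrad x
    rw [← ofReal_norm]
    by_cases hx : x ∈ A
    · rw [indicator_of_mem hx] at h1
      rw [indicator_of_mem hx, ← ofReal_norm]
      exact ENNReal.ofReal_le_ofReal h1
    · rw [indicator_of_notMem hx] at h1
      rw [indicator_of_notMem hx]
      have : ‖fderiv ℝ w x‖ = 0 := le_antisymm h1 (norm_nonneg _)
      simp [this]
  -- Chebyshev on `L^{3/2}` for `w`
  have hhk : 0 < h - k := by linarith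
  have hcheb : volume {x | h < ‖v x‖} ≤
      ENNReal.ofReal ((4 / (h - k)) ^ (3 / 2 : ℝ)) * ∫⁻ x, ‖w x‖ₑ ^ (3 / 2 : ℝ) := by
    set ε : ℝ≥0∞ := ENNReal.ofReal (((h - k) / 4) ^ (3 / 2 : ℝ)) with hε
    have hεpos : 0 < ((h - k) / 4) ^ (3 / 2 : ℝ) := Real.rpow_pos_of_pos (by positivity) _
    have hε0 : ε ≠ 0 := by rw [hε]; exact ENNReal.ofReal_ne_zero_iff.2 hεpos
    have hsub : {x | h < ‖v x‖} ⊆ {x | ε ≤ ‖w x‖ₑ ^ (3 / 2 : ℝ)} := by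
      intro x hx
      have hwx : (h - k) / 4 ≤ w x := hwlow x hx
      show ε ≤ ‖w x‖ₑ ^ (3 / 2 : ℝ)
      rw [hε, ← ofReal_norm, ENNReal.ofReal_rpow_of_nonneg (norm_nonneg _) (by norm_num),
        Real.norm_eq_abs, abs_of_nonneg (hw0 x)]
      exact ENNReal.ofReal_le_ofReal (Real.rpow_le_rpow (by positivity) hwx (by norm_num))
    have hmeas : AEMeasurable (fun x => ‖w x‖ₑ ^ (3 / 2 : ℝ)) volume :=
      hw_meas.enorm.pow_const _
    calc volume {x | h < ‖v x‖} ≤ volume {x | ε ≤ ‖w x‖ₑ ^ (3 / 2 : ℝ)} := measure_mono hsub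
      _ ≤ (∫⁻ x, ‖w x‖ₑ ^ (3 / 2 : ℝ)) / ε :=
          meas_ge_le_lintegral_div hmeas hε0 ENNReal.ofReal_ne_top
      _ = ENNReal.ofReal ((4 / (h - k)) ^ (3 / 2 : ℝ)) * ∫⁻ x, ‖w x‖ₑ ^ (3 / 2 : ℝ) := by
          rw [div_eq_mul_inv, mul_comm, hε, ← ENNReal.ofReal_inv_of_pos hεpos,
            ← Real.inv_rpow (by positivity), inv_div]
  -- combine
  calc volume {x | h < ‖v x‖}
      ≤ ENNReal.ofReal ((4 / (h - k)) ^ (3 / 2 : ℝ)) * ∫⁻ x, ‖w x‖ₑ ^ (3 / 2 : ℝ) := hcheb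
    _ ≤ ENNReal.ofReal ((4 / (h - k)) ^ (3 / 2 : ℝ)) *
        ((C₁ : ℝ≥0∞) * (∫⁻ x, ‖fderiv ℝ w x‖ₑ) ^ (3 / 2 : ℝ)) := by
        gcongr
    _ ≤ ENNReal.ofReal ((4 / (h - k)) ^ (3 / 2 : ℝ)) *
        ((C₁ : ℝ≥0∞) * (∫⁻ x, A.indicator (fun x => ‖fderiv ℝ (fun y => ‖v y‖) x‖ₑ) x) ^
          (3 / 2 : ℝ)) := by
        gcongr
    _ = _ := by ring

/-- **Isoperimetric level gain (dyadic real form).** There is an absolute constant `C > 0` such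
that for every `C¹` field `v` on `ℝ³` and every level `c > 0` with `{|v| > c}` bounded:
`c · |{|v| > 2c}|^{2/3} ≤ C · ∫ 1_{|v|>c} ‖∇|v|‖` (the `2/3`-power of `sliceVolumeGain_one` with
`k = c`, `h = 2c`; the integral is finite by `lintegral_indicator_fderiv_norm_lt_top`, so the
real-valued form loses nothing). First lemma `IsoperimetricLevelGain` of the crux idea
`iso-speed-area-closure`. [folklore] -/
theorem isoperimetricLevelGain :
    ∃ C : ℝ, 0 < C ∧ ∀ (v : EuclideanSpace ℝ (Fin 3) → EuclideanSpace ℝ (Fin 3)) (c : ℝ),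
      0 < c → ContDiff ℝ 1 v → Bornology.IsBounded {x | c < ‖v x‖} →
      c * (MeasureTheory.volume {x | 2 * c < ‖v x‖}).toReal ^ ((2 : ℝ) / 3) ≤
        C * (∫⁻ x, Set.indicator {x | c < ‖v x‖}
          (fun x => ENNReal.ofReal ‖fderiv ℝ (fun y => ‖v y‖) x‖) x).toReal := by
  set C₁ : ℝ≥0 := lintegralPowLePowLIntegralFDerivConst
    (volume : Measure (EuclideanSpace ℝ (Fin 3))) (3 / 2 : ℝ) with hC₁
  refine ⟨4 * (C₁ : ℝ) ^ ((2 : ℝ) / 3) + 1, by positivity, ?_⟩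
  intro v c hc hv hbdd
  set A : Set (EuclideanSpace ℝ (Fin 3)) := {x | c < ‖v x‖} with hA
  set I : ℝ≥0∞ := ∫⁻ x, A.indicator (fun x => ‖fderiv ℝ (fun y => ‖v y‖) x‖ₑ) x with hI
  have hIfin : I < ∞ := lintegral_indicator_fderiv_norm_lt_top hv hc hbdd
  -- the integrand of the statement is the `ofReal` spelling of the same integrand
  have hI' : (∫⁻ x, A.indicator (fun x => ENNReal.ofReal ‖fderiv ℝ (fun y => ‖v y‖) x‖) x) = I := by
    rw [hI]
    refine lintegral_congr fun x => ?_
    by_cases hx : x ∈ A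
    · rw [indicator_of_mem hx, indicator_of_mem hx, ofReal_norm]
    · rw [indicator_of_notMem hx, indicator_of_notMem hx]
  rw [hI']
  have hgain := sliceVolumeGain_one v c (2 * c) hv hc (by linarith) hbdd
  have h2c : 2 * c - c = c := by ring
  rw [h2c] at hgain
  -- pass to real numbers
  set V : ℝ≥0∞ := volume {x | 2 * c < ‖v x‖} with hV
  have hVfin : V < ∞ := by
    refine (measure_mono ?_).trans_lt hbdd.isCompact_closure.measure_lt_top
    intro x hx
    exact subset_closure (show c < ‖v x‖ by have : 2 * c < ‖v x‖ := hx; linarith)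
  have hreal : V.toReal ≤ (4 / c) ^ (3 / 2 : ℝ) * (C₁ : ℝ) * I.toReal ^ (3 / 2 : ℝ) := by
    have h1 := ENNReal.toReal_mono (by
      refine ENNReal.mul_ne_top (ENNReal.mul_ne_top ENNReal.ofReal_ne_top ENNReal.coe_ne_top) ?_
      exact (ENNReal.rpow_lt_top_of_nonneg (by norm_num) hIfin.ne).ne) hgain
    rw [ENNReal.toReal_mul, ENNReal.toReal_mul, ENNReal.toReal_ofReal (by positivity),
      ENNReal.coe_toReal, ← ENNReal.toReal_rpow] at h1
    exact h1
  -- take the `2/3` power and multiply by `c`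
  have hV0 : 0 ≤ V.toReal := ENNReal.toReal_nonneg
  have hI0 : 0 ≤ I.toReal := ENNReal.toReal_nonneg
  have hC₁0 : 0 ≤ (C₁ : ℝ) := C₁.coe_nonneg
  have hpow : V.toReal ^ ((2 : ℝ) / 3) ≤ (4 / c) * (C₁ : ℝ) ^ ((2 : ℝ) / 3) * I.toReal := by
    calc V.toReal ^ ((2 : ℝ) / 3)
        ≤ ((4 / c) ^ (3 / 2 : ℝ) * (C₁ : ℝ) * I.toReal ^ (3 / 2 : ℝ)) ^ ((2 : ℝ) / 3) :=
          Real.rpow_le_rpow hV0 hreal (by norm_num)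
      _ = (4 / c) * (C₁ : ℝ) ^ ((2 : ℝ) / 3) * I.toReal := by
          rw [Real.mul_rpow (by positivity) (by positivity),
            Real.mul_rpow (by positivity) hC₁0, ← Real.rpow_mul (by positivity),
            ← Real.rpow_mul hI0]
          norm_num
  calc c * V.toReal ^ ((2 : ℝ) / 3)
      ≤ c * ((4 / c) * (C₁ : ℝ) ^ ((2 : ℝ) / 3) * I.toReal) :=
        mul_le_mul_of_nonneg_left hpow hc.le
    _ = 4 * (C₁ : ℝ) ^ ((2 : ℝ) / 3) * I.toReal := by
        field_simp
    _ ≤ (4 * (C₁ : ℝ) ^ ((2 : ℝ) / 3) + 1) * I.toReal := by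
        nlinarith [Real.rpow_nonneg hC₁0 ((2 : ℝ) / 3)]

end Summit.NavierStokesRegularity.NavierStokesRegularity.Theorems

end
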